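import Mathlib
import HarnessLib

/-!
# `NoHeavyLowerTail` (stmt-CriticalPhenomena-4575) — structure of `J*` and admissibility of the swap Φ (L4.2, L5.4 of U1-PROOF.md; blueprint B4b)

Support file (prover `prim-gen-swap` gen 13; `--supports stmt-CriticalPhenomena-4575`).  No definitions, no named facts, no sorries.

Classes `X : ι` (linear order = leaf-peeling order on the forest part `F`), port pairs `s(P X, P' X)` (`P` = attachment end, `P'` = leaf end
on `F`; `hforest : K < I ⇒ P' K ∉ ports I`), pairwise distinct; the fixed port `r`; child edges `A ∈ F` with `P A = r`; the leaf class `I₀ ∈ F`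
with `P' I₀ = r`; a dominator choice `dom X d ∈ F` for chords `X ∉ F` (through `d`, other port off `X`).  "`X` hot at `d`" means `r ∈ dom X d`.
For a non-regular charged unit `(S, X)` (hub `X` a chord avoiding `r`, every class of `S` adjacent to `X`) whose first open forest class
`J = J*(S)` is not a child edge, U1-PROOF.md L4.2 says: `J` meets `X` at one end `e` only, and either `J = I₀` (then `e = q₀ = P I₀`) or `J`
avoids `r` and `X` is hot at the other end `ē`; L5.4(b),(c) then verify the admissibility conditions (Φ1)–(Φ4) of the swap `S ↦ S − X + A(ē)`
in the form consumed by `StarSet.swap_mem_cred` (…StarSetSwapCredit).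

* `StarSet.child_lt_leafClass`, `StarSet.leafClass_unique` — child edges precede `I₀`; `I₀` is unique;
* `StarSet.chord_far_of_not_mem` — a chord avoiding `r` and the port `d` is not adjacent to `A(d)`;
* `StarSet.jstar_structure` — L4.2;
* `StarSet.swap_admissible_I` — L5.4(b): `J = I₀`, `ē` C-hot ⇒ (Φ1)–(Φ4);
* `StarSet.swap_admissible_H` — L5.4(c): `J` avoids `r`, `ē` C-hot, `¬ J < A(ē)`, no r-free triangle in `S` ⇒ (Φ3), (Φ4).
-/

namespace Summit.CriticalPhenomena.PercolationContinuityZ3.Theorems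

open Finset
open scoped BigOperators

namespace StarSet

variable {ι V : Type*} [LinearOrder ι]

/-- Child edges precede the leaf class at `r`: `A ∈ F`, `P A = r`, `I₀ ∈ F`, `P' I₀ = r` ⇒ `A < I₀`. [U1-PROOF.md §0] -/
theorem child_lt_leafClass (P P' : ι → V) (hPP' : ∀ X, P X ≠ P' X) (r : V) (F : Finset ι)
    (hforest : ∀ K ∈ F, ∀ I ∈ F, K < I → P' K ≠ P I ∧ P' K ≠ P' I)
    {A I₀ : ι} (hA : A ∈ F) (hAr : P A = r) (hI₀ : I₀ ∈ F) (hI₀r : P' I₀ = r) : A < I₀ := by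
  rcases lt_trichotomy A I₀ with h | h | h
  · exact h
  · exact absurd (hAr.trans (h ▸ hI₀r).symm) (hPP' A)
  · exact absurd (hI₀r.trans hAr.symm) (hforest I₀ hI₀ A hA h).1

/-- The leaf class at `r` is unique. [U1-PROOF.md §0] -/
theorem leafClass_unique (P P' : ι → V) (r : V) (F : Finset ι)
    (hforest : ∀ K ∈ F, ∀ I ∈ F, K < I → P' K ≠ P I ∧ P' K ≠ P' I)
    {I J : ι} (hI : I ∈ F) (hIr : P' I = r) (hJ : J ∈ F) (hJr : P' J = r) : I = J := by
  rcases lt_trichotomy I J with h | h | h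
  · exact absurd (hIr.trans hJr.symm) (hforest I hI J hJ h).2
  · exact h
  · exact absurd (hJr.trans hIr.symm) (hforest J hJ I hI h).2

omit [LinearOrder ι] in
/-- A class avoiding `r` and the port `d` is not adjacent to a class with ports `{d, r}` (`hfar` of `swap_mem_cred`). -/
theorem chord_far_of_not_mem (P P' : ι → V) (r d : V) (A μ : ι) (hA : (P A = d ∧ P' A = r) ∨ (P A = r ∧ P' A = d))
    (hμr : P μ ≠ r ∧ P' μ ≠ r) (hμd : ¬ (P μ = d ∨ P' μ = d)) :
    ¬ (P A = P μ ∨ P A = P' μ ∨ P' A = P μ ∨ P' A = P' μ) := by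
  rintro (h | h | h | h) <;> rcases hA with ⟨h1, h2⟩ | ⟨h1, h2⟩
  · exact hμd (Or.inl (h1 ▸ h).symm)
  · exact hμr.1 (h1 ▸ h).symm
  · exact hμd (Or.inr (h1 ▸ h).symm)
  · exact hμr.2 (h1 ▸ h).symm
  · exact hμr.1 (h2 ▸ h).symm
  · exact hμd (Or.inl (h2 ▸ h).symm)
  · exact hμr.2 (h2 ▸ h).symm
  · exact hμd (Or.inr (h2 ▸ h).symm)

omit [LinearOrder ι] in
/-- **L4.2 of U1-PROOF.md (structure of `J*`).**  Let `X ∉ F` avoid `r`, `J ∈ F` be adjacent to `X` with `P J ≠ r` (not a child edge), port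
pairs distinct, and suppose the pair `(X, J)` is NON-REGULAR: whenever `J` meets `X` exactly at `e` (other end `ē` of `X`, other port `s` of
`J`), `s = r` or `X` is hot at `ē`.  Then `J` meets `X` at exactly one end `e`, and either `J = {e, r}` with `P' J = r` (so `J = I₀`,
`e = q₀`), or `J` avoids `r` and `X` is hot at `ē`. -/
theorem jstar_structure (P P' : ι → V) (hPP' : ∀ X, P X ≠ P' X)
    (hinj : Function.Injective fun X => (s(P X, P' X) : Sym2 V)) (r : V) (F : Finset ι) (dom : ι → V → ι)
    {X J : ι} (hXF : X ∉ F) (hXr : P X ≠ r ∧ P' X ≠ r) (hJF : J ∈ F) (hJr : P J ≠ r)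
    (hadj : P J = P X ∨ P J = P' X ∨ P' J = P X ∨ P' J = P' X)
    (hNR : ∀ e ē s : V, ((P X = e ∧ P' X = ē) ∨ (P X = ē ∧ P' X = e)) →
      ((P J = e ∧ P' J = s) ∨ (P J = s ∧ P' J = e)) → s ≠ ē → (s = r ∨ (P (dom X ē) = r ∨ P' (dom X ē) = r))) :
    ∃ e ē : V, ((P X = e ∧ P' X = ē) ∨ (P X = ē ∧ P' X = e)) ∧ (P J = e ∨ P' J = e) ∧ ¬ (P J = ē ∨ P' J = ē) ∧
      ((P J = e ∧ P' J = r) ∨ (P J ≠ r ∧ P' J ≠ r ∧ (P (dom X ē) = r ∨ P' (dom X ē) = r))) := by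
  have hJX : J ≠ X := fun h => hXF (h ▸ hJF)
  -- `J` does not contain both ports of `X`
  have hnotboth : ¬ ((P J = P X ∨ P' J = P X) ∧ (P J = P' X ∨ P' J = P' X)) := by
    rintro ⟨h1, h2⟩
    apply hJX
    apply hinj
    simp only
    rcases h1 with h1 | h1 <;> rcases h2 with h2 | h2
    · exact absurd (h1.symm.trans h2) (hPP' X)
    · rw [h1, h2]
    · rw [h1, h2]; exact Sym2.eq_swap
    · exact absurd (h1.symm.trans h2) (hPP' X)
  -- choose the common end `e` and the data
  obtain ⟨e, ē, hX, hJe, hJē⟩ : ∃ e ē : V, ((P X = e ∧ P' X = ē) ∨ (P X = ē ∧ P' X = e)) ∧ (P J = e ∨ P' J = e) ∧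
      ¬ (P J = ē ∨ P' J = ē) := by
    rcases hadj with h | h | h | h
    · exact ⟨P X, P' X, Or.inl ⟨rfl, rfl⟩, Or.inl h, fun h' => hnotboth ⟨Or.inl h, h'⟩⟩
    · exact ⟨P' X, P X, Or.inr ⟨rfl, rfl⟩, Or.inl h, fun h' => hnotboth ⟨h', Or.inl h⟩⟩
    · exact ⟨P X, P' X, Or.inl ⟨rfl, rfl⟩, Or.inr h, fun h' => hnotboth ⟨Or.inr h, h'⟩⟩
    · exact ⟨P' X, P X, Or.inr ⟨rfl, rfl⟩, Or.inr h, fun h' => hnotboth ⟨h', Or.inr h⟩⟩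
  refine ⟨e, ē, hX, hJe, hJē, ?_⟩
  have heē : e ≠ ē := by
    rcases hX with ⟨h1, h2⟩ | ⟨h1, h2⟩
    · rw [← h1, ← h2]; exact hPP' X
    · rw [← h1, ← h2]; exact (hPP' X).symm
  have her : e ≠ r := by
    rcases hX with ⟨h1, _⟩ | ⟨_, h2⟩
    · rw [← h1]; exact hXr.1
    · rw [← h2]; exact hXr.2
  -- the other port `s` of `J`
  rcases hJe with hJe | hJe
  · -- `P J = e`, `s = P' J`
    by_cases hJ'r : P' J = r
    · exact Or.inl ⟨hJe, hJ'r⟩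
    · have hs : P' J ≠ ē := fun h => hJē (Or.inr h)
      rcases hNR e ē (P' J) hX (Or.inl ⟨hJe, rfl⟩) hs with h | h
      · exact absurd h hJ'r
      · exact Or.inr ⟨hJr, hJ'r, h⟩
  · -- `P' J = e`, `s = P J ≠ r`
    have hs : P J ≠ ē := fun h => hJē (Or.inl h)
    rcases hNR e ē (P J) hX (Or.inr ⟨rfl, hJe⟩) hs with h | h
    · exact absurd h hJr
    · exact Or.inr ⟨hJr, fun h' => her (hJe.symm.trans h'), h⟩

/-- **L5.4(b) of U1-PROOF.md (I₀-configurations).**  If the first open forest class of `S` is `J = I₀ = {e, r}` (`P J = e = q₀`, `P' J = r`),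
the hub `X = {e, ē}` is a chord avoiding `r`, and `X` is C-hot at `ē` (`P (dom X ē) = r`), then with `A := dom X ē`: `A` is the child edge `{ē, r}`,
`A ∉ S` (Φ1), no other chord of `S` through `ē` avoiding `r` is adjacent to `J` (Φ3), and every forest class of `S` is above `A` (Φ4). -/
theorem swap_admissible_I (P P' : ι → V) (hPP' : ∀ X, P X ≠ P' X)
    (hinj : Function.Injective fun X => (s(P X, P' X) : Sym2 V)) (r : V) (F : Finset ι)
    (hforest : ∀ K ∈ F, ∀ I ∈ F, K < I → P' K ≠ P I ∧ P' K ≠ P' I) (dom : ι → V → ι)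
    (hdom : ∀ X ∉ F, ∀ d, (P X = d ∨ P' X = d) →
      dom X d ∈ F ∧ (P (dom X d) = d ∨ P' (dom X d) = d) ∧
        (∀ u, (P (dom X d) = u ∨ P' (dom X d) = u) → (P X = u ∨ P' X = u) → u = d))
    {X J : ι} {e ē : V} (hXF : X ∉ F) (hXr : P X ≠ r ∧ P' X ≠ r) (hX : (P X = e ∧ P' X = ē) ∨ (P X = ē ∧ P' X = e))
    (S : Finset ι) (hJF : J ∈ F) (hJmin : ∀ I ∈ S, I ∈ F → J ≤ I) (hJ : P J = e ∧ P' J = r)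
    (hChot : P (dom X ē) = r) :
    (dom X ē ∈ F ∧ P (dom X ē) = r ∧ P' (dom X ē) = ē) ∧ dom X ē ∉ S ∧
      (∀ μ, μ ∉ F → (P μ ≠ r ∧ P' μ ≠ r) → μ ≠ X → (P μ = ē ∨ P' μ = ē) →
        ¬ (P J = P μ ∨ P J = P' μ ∨ P' J = P μ ∨ P' J = P' μ)) ∧
      (∀ I ∈ F, I ∈ S → dom X ē < I) := by
  have hēX : P X = ē ∨ P' X = ē := by
    rcases hX with ⟨_, h⟩ | ⟨h, _⟩
    · exact Or.inr h
    · exact Or.inl h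
  have hēr : ē ≠ r := by
    rcases hX with ⟨_, h⟩ | ⟨h, _⟩
    · rw [← h]; exact hXr.2
    · rw [← h]; exact hXr.1
  have heē : e ≠ ē := by
    rcases hX with ⟨h1, h2⟩ | ⟨h1, h2⟩
    · rw [← h1, ← h2]; exact hPP' X
    · rw [← h1, ← h2]; exact (hPP' X).symm
  obtain ⟨hAF, hAē, -⟩ := hdom X hXF ē hēX
  have hA' : P' (dom X ē) = ē := hAē.resolve_left (fun h => hēr (h.symm.trans hChot))
  have hAlt : dom X ē < J := child_lt_leafClass P P' hPP' r F hforest hAF hChot hJF hJ.2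
  refine ⟨⟨hAF, hChot, hA'⟩, fun hAS => absurd (hJmin _ hAS hAF) (not_le.2 hAlt), ?_, fun I hI hIS => lt_of_lt_of_le hAlt (hJmin I hIS hI)⟩
  intro μ hμF hμr hμX hμē hadj
  -- `J = {e, r}` adjacent to `μ ∌ r` forces `e ∈ μ`, hence `μ = X`
  have hμe : P μ = e ∨ P' μ = e := by
    rcases hadj with h | h | h | h
    · exact Or.inl (h.symm.trans hJ.1)
    · exact Or.inr (h.symm.trans hJ.1)
    · exact absurd (hJ.2.symm.trans h) (Ne.symm hμr.1)
    · exact absurd (hJ.2.symm.trans h) (Ne.symm hμr.2)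
  apply hμX
  apply hinj
  simp only
  rcases hμe with h1 | h1 <;> rcases hμē with h2 | h2
  · exact absurd (h1.symm.trans h2) heē
  · rcases hX with ⟨h3, h4⟩ | ⟨h3, h4⟩
    · rw [h1, h2, h3, h4]
    · rw [h1, h2, h3, h4]; exact Sym2.eq_swap
  · rcases hX with ⟨h3, h4⟩ | ⟨h3, h4⟩
    · rw [h1, h2, h3, h4]; exact Sym2.eq_swap
    · rw [h1, h2, h3, h4]
  · exact absurd (h1.symm.trans h2) heē

/-- **L5.4(c) of U1-PROOF.md (unblocked H-configurations).**  If the first open forest class `J` of `S` avoids `r` and meets the hub `X = {e, ē}`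
(a chord avoiding `r`) exactly at `e`, `X` is C-hot at `ē` with `¬ J < A` for `A := dom X ē`, and `S` contains no r-free triangle, then
`A = {ē, r} ∈ Ch`, no other chord of `S` through `ē` avoiding `r` is adjacent to `J` (Φ3), and every forest class of `S` is above `A` (Φ4)
((Φ1) `A ∉ S` is the remaining "not blocked" hypothesis of the caller). -/
theorem swap_admissible_H [DecidableEq V] (P P' : ι → V) (hPP' : ∀ X, P X ≠ P' X)
    (hinj : Function.Injective fun X => (s(P X, P' X) : Sym2 V)) (r : V) (F : Finset ι) (dom : ι → V → ι)
    (hdom : ∀ X ∉ F, ∀ d, (P X = d ∨ P' X = d) →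
      dom X d ∈ F ∧ (P (dom X d) = d ∨ P' (dom X d) = d) ∧
        (∀ u, (P (dom X d) = u ∨ P' (dom X d) = u) → (P X = u ∨ P' X = u) → u = d))
    {X J : ι} {e ē : V} (hXF : X ∉ F) (hXr : P X ≠ r ∧ P' X ≠ r) (hX : (P X = e ∧ P' X = ē) ∨ (P X = ē ∧ P' X = e))
    (S : Finset ι) (hXS : X ∈ S) (hJS : J ∈ S) (hJmin : ∀ I ∈ S, I ∈ F → J ≤ I)
    (hJr : P J ≠ r ∧ P' J ≠ r) (hJe : P J = e ∨ P' J = e) (hJē : ¬ (P J = ē ∨ P' J = ē))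
    (hChot : P (dom X ē) = r) (hJA : ¬ J < dom X ē)
    (hnotri : ¬ ∃ a b c : V, a ≠ b ∧ a ≠ c ∧ b ≠ c ∧ a ≠ r ∧ b ≠ r ∧ c ≠ r ∧
      (∃ X ∈ S, (s(P X, P' X) : Sym2 V) = s(a, b)) ∧ (∃ Y ∈ S, (s(P Y, P' Y) : Sym2 V) = s(a, c)) ∧
        ∃ Z ∈ S, (s(P Z, P' Z) : Sym2 V) = s(b, c)) :
    (dom X ē ∈ F ∧ P (dom X ē) = r ∧ P' (dom X ē) = ē) ∧
      (∀ μ, μ ∉ F → (P μ ≠ r ∧ P' μ ≠ r) → μ ∈ S → μ ≠ X → (P μ = ē ∨ P' μ = ē) →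
        ¬ (P J = P μ ∨ P J = P' μ ∨ P' J = P μ ∨ P' J = P' μ)) ∧
      (∀ I ∈ F, I ∈ S → dom X ē < I) := by
  have hēX : P X = ē ∨ P' X = ē := by
    rcases hX with ⟨_, h⟩ | ⟨h, _⟩
    · exact Or.inr h
    · exact Or.inl h
  have heX : P X = e ∨ P' X = e := by
    rcases hX with ⟨h, _⟩ | ⟨_, h⟩
    · exact Or.inl h
    · exact Or.inr h
  have hēr : ē ≠ r := by
    rcases hX with ⟨_, h⟩ | ⟨h, _⟩
    · rw [← h]; exact hXr.2
    · rw [← h]; exact hXr.1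
  have her : e ≠ r := by
    rcases hX with ⟨h, _⟩ | ⟨_, h⟩
    · rw [← h]; exact hXr.1
    · rw [← h]; exact hXr.2
  have heē : e ≠ ē := by
    rcases hX with ⟨h1, h2⟩ | ⟨h1, h2⟩
    · rw [← h1, ← h2]; exact hPP' X
    · rw [← h1, ← h2]; exact (hPP' X).symm
  obtain ⟨hAF, hAē, -⟩ := hdom X hXF ē hēX
  have hA' : P' (dom X ē) = ē := hAē.resolve_left (fun h => hēr (h.symm.trans hChot))
  have hAJ : dom X ē ≠ J := fun h => hJr.1 (h ▸ hChot)
  have hAlt : dom X ē < J := lt_of_le_of_ne (not_lt.1 hJA) hAJ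
  refine ⟨⟨hAF, hChot, hA'⟩, ?_, fun I hI hIS => lt_of_lt_of_le hAlt (hJmin I hIS hI)⟩
  intro μ hμF hμr hμS hμX hμē hadj
  -- the other port `s` of `J`
  obtain ⟨s, hJs, hse⟩ : ∃ s, ((P J = e ∧ P' J = s) ∨ (P J = s ∧ P' J = e)) ∧ s ≠ e := by
    rcases hJe with h | h
    · exact ⟨P' J, Or.inl ⟨h, rfl⟩, fun h' => hPP' J (h.trans h'.symm)⟩
    · exact ⟨P J, Or.inr ⟨rfl, h⟩, fun h' => hPP' J (h'.trans h.symm)⟩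
  have hsr : s ≠ r := by
    rcases hJs with ⟨_, h⟩ | ⟨h, _⟩
    · rw [← h]; exact hJr.2
    · rw [← h]; exact hJr.1
  have hsē : s ≠ ē := by
    rcases hJs with ⟨_, h⟩ | ⟨h, _⟩
    · exact fun h' => hJē (Or.inr (h.trans h'))
    · exact fun h' => hJē (Or.inl (h.trans h'))
  -- `e ∉ μ` (else `μ = X`)
  have hμe : ¬ (P μ = e ∨ P' μ = e) := by
    intro h
    apply hμX
    apply hinj
    simp only
    rcases h with h1 | h1 <;> rcases hμē with h2 | h2
    · exact absurd (h1.symm.trans h2) heē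
    · rcases hX with ⟨h3, h4⟩ | ⟨h3, h4⟩
      · rw [h1, h2, h3, h4]
      · rw [h1, h2, h3, h4]; exact Sym2.eq_swap
    · rcases hX with ⟨h3, h4⟩ | ⟨h3, h4⟩
      · rw [h1, h2, h3, h4]; exact Sym2.eq_swap
      · rw [h1, h2, h3, h4]
    · exact absurd (h1.symm.trans h2) heē
  -- so `s ∈ μ`
  have hμs : P μ = s ∨ P' μ = s := by
    rcases hadj with h | h | h | h <;> rcases hJs with ⟨h1, h2⟩ | ⟨h1, h2⟩
    · exact absurd (Or.inl (h.symm.trans h1)) hμe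
    · exact Or.inl (h.symm.trans h1)
    · exact absurd (Or.inr (h.symm.trans h1)) hμe
    · exact Or.inr (h.symm.trans h1)
    · exact Or.inl (h.symm.trans h2)
    · exact absurd (Or.inl (h.symm.trans h2)) hμe
    · exact Or.inr (h.symm.trans h2)
    · exact absurd (Or.inr (h.symm.trans h2)) hμe
  -- the r-free triangle `X = eē`, `J = es`, `μ = ēs`
  have hsX : (s(P X, P' X) : Sym2 V) = s(e, ē) := by
    rcases hX with ⟨h1, h2⟩ | ⟨h1, h2⟩
    · rw [h1, h2]
    · rw [h1, h2]; exact Sym2.eq_swap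
  have hsJ : (s(P J, P' J) : Sym2 V) = s(e, s) := by
    rcases hJs with ⟨h1, h2⟩ | ⟨h1, h2⟩
    · rw [h1, h2]
    · rw [h1, h2]; exact Sym2.eq_swap
  have hsμ : (s(P μ, P' μ) : Sym2 V) = s(ē, s) := by
    rcases hμē with h1 | h1 <;> rcases hμs with h2 | h2
    · exact absurd (h1.symm.trans h2) (Ne.symm hsē)
    · rw [h1, h2]
    · rw [h1, h2]; exact Sym2.eq_swap
    · exact absurd (h1.symm.trans h2) (Ne.symm hsē)
  exact hnotri ⟨e, ē, s, heē, hse.symm, Ne.symm hsē, her, hēr, hsr, ⟨X, hXS, hsX⟩, ⟨J, hJS, hsJ⟩, ⟨μ, hμS, hsμ⟩⟩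

end StarSet

end Summit.CriticalPhenomena.PercolationContinuityZ3.Theorems
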